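import Literature.AlgebraicGeometry.Motives.GrassmannianChartUniversal
import Literature.AlgebraicGeometry.Motives.GrassmannianChartNatural
import HarnessLib

/-!
# The universal property of the standard chart: `U_I` is represented by the polynomial ring `R[X_{j i} : j ∉ I, i < k]`

Topic `Literature/AlgebraicGeometry/Motives`; namespace `Literature.AlgebraicGeometry.Motives`, prefix `Grassmannian.`.  Sequel to
`GrassmannianChartColumns` and `GrassmannianChartNatural`; cell hodgecm-mathlib key (h4) (author B-p21 (g15), partner B-p18 (g17)),
the ring side of the (A3) step «`f_x : yoneda.obj 𝔸 ⟶ Gr` from the universal chart element, bijective on every `Spec A`»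
(B-p21 (g15) / B-p09 (g12)).  THEOREMS ONLY — the theory of the objects `coordMapOfColumns`, `univCoordMap`, `univChart` of
`GrassmannianChartUniversal`; no definition, no instance, no notation, no `sorry`.

Fix a free `R`-module `M` with basis `b : J → M`, `I : Fin k → J` injective, `σ := {j // j ∉ range I}` and the polynomial ring
`P := R[X_{(j,i)} : (j,i) ∈ σ × Fin k]` (`MvPolynomial (σ × Fin k) R`).

* `Grassmannian.coordMapOfColumns b I v : M →ₗ[R] Aᵏ` — THE coordinate map with `I`-columns the identity and free columns `v : σ → Aᵏ`
  (explicit inverse of ★ `bijective_restrictColumns`); `_frame`, `_basis`, `restrict_coordMapOfColumns`, `coordMapOfColumns_restrict`,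
  `compLeft_comp_coordMapOfColumns` (naturality);
* `Grassmannian.univCoordMap b I : M →ₗ[R] Pᵏ` — free columns the variables `X_{(j,i)}`; `aeval_compLeft_univCoordMap` — evaluating the
  variables at `v` gives `coordMapOfColumns b I v`; `algHom_ext_univCoordMap` — an algebra map out of `P` is determined by its composite
  with `univCoordMap`;
* `Grassmannian.ofCoordMap_congr`, `Grassmannian.ofCoordMap_injective` — ★ `ofCoordMap` as a function of the coordinate map;
* **`Grassmannian.univChart b I hI : G(k, P ⊗ M; P)`**, `univChart_mem_chart` — THE UNIVERSAL POINT OF THE CHART `U_I`;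
* **`Grassmannian.map_aeval_univChart`** — `map (aeval v) univChart = ofCoordMap (b ∘ I) (coordMapOfColumns b I v)`;
* **`Grassmannian.existsUnique_algHom_map_univChart_eq`** — UNIVERSAL PROPERTY: every `N ∈ chart (b ∘ I) A` is `map φ univChart` for a
  UNIQUE `R`-algebra map `φ : P → A` (for `A` in the universe of `P`, as Mathlib's `Module.Grassmannian.map` requires); i.e. the chart
  subfunctor `U_I` is represented by `Spec P = 𝔸^{k · #σ}` with universal element `univChart` ([Stacks 089T]; EGA I 9.7.4;
  [EisenbudHarris2016, §3.2.2]).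

HC_CM is proved only modulo the 7 printed citations until rung 0 closes; nothing here is about HC.

## References
* [StacksProject, Tag 089T]; A. Grothendieck, EGA I (Springer 1971), §9.7.4; [EisenbudHarris2016, §3.2.2].
-/

noncomputable section

universe u v w

open TensorProduct

namespace Literature.AlgebraicGeometry.Motives

namespace Grassmannian

variable {R : Type u} [CommRing R] {M : Type v} [AddCommGroup M] [Module R M] {k : ℕ} {J : Type v}
variable {A : Type w} [CommRing A] [Algebra R A] {B : Type w} [CommRing B] [Algebra R B]

/-! ## §1 The coordinate map with prescribed free columns -/

/-- On the `I`-columns the coordinate map is the identity (`I` injective). [cite: EisenbudHarris2016, §3.2.2] -/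
theorem coordMapOfColumns_frame (b : Module.Basis J R M) (I : Fin k → J) (hI : Function.Injective I)
    (v : {j : J // j ∉ Set.range I} → (Fin k → A)) (i : Fin k) :
    coordMapOfColumns b I v (b (I i)) = Pi.single i 1 := by
  rw [coordMapOfColumns, Module.Basis.constr_basis]
  have h : ∃ i', I i' = I i := ⟨i, rfl⟩
  rw [dif_pos h, hI h.choose_spec]

/-- On the free columns the coordinate map is `v`. [cite: EisenbudHarris2016, §3.2.2] -/
theorem coordMapOfColumns_basis (b : Module.Basis J R M) (I : Fin k → J) (v : {j : J // j ∉ Set.range I} → (Fin k → A))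
    (j : J) (hj : j ∉ Set.range I) : coordMapOfColumns b I v (b j) = v ⟨j, hj⟩ := by
  rw [coordMapOfColumns, Module.Basis.constr_basis]
  have h : ¬ ∃ i, I i = j := fun h => hj (Set.mem_range.2 h)
  rw [dif_neg h]

/-- Restricting the coordinate map with columns `v` to the free columns gives back `v`. [cite: EisenbudHarris2016, §3.2.2] -/
theorem restrict_coordMapOfColumns (b : Module.Basis J R M) (I : Fin k → J) (v : {j : J // j ∉ Set.range I} → (Fin k → A)) :
    (fun j : {j : J // j ∉ Set.range I} => coordMapOfColumns b I v (b j.1)) = v :=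
  funext fun j => coordMapOfColumns_basis b I v j.1 j.2

/-- A normalised coordinate map is the coordinate map of its free columns. [cite: EisenbudHarris2016, §3.2.2] -/
theorem coordMapOfColumns_restrict (b : Module.Basis J R M) (I : Fin k → J) (hI : Function.Injective I)
    (ψ : M →ₗ[R] (Fin k → A)) (hψ : ∀ i, ψ (b (I i)) = Pi.single i 1) :
    coordMapOfColumns b I (fun j : {j : J // j ∉ Set.range I} => ψ (b j.1)) = ψ :=
  coordMaps_ext_basis b I (coordMapOfColumns_frame b I hI _) hψ fun j hj => coordMapOfColumns_basis b I _ j hj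

/-- **Naturality**: `f ∘ coordMapOfColumns v = coordMapOfColumns (f ∘ v)` (for `R`-algebra maps `f : S₁ → S₂` between algebras in
ANY two universes — the polynomial ring below need not live in the universe of its points). [cite: EisenbudHarris2016, §3.2.2] -/
theorem compLeft_comp_coordMapOfColumns {S₁ : Type*} [CommRing S₁] [Algebra R S₁] {S₂ : Type*} [CommRing S₂] [Algebra R S₂]
    (f : S₁ →ₐ[R] S₂) (b : Module.Basis J R M) (I : Fin k → J) (hI : Function.Injective I)
    (v : {j : J // j ∉ Set.range I} → (Fin k → S₁)) :
    f.toLinearMap.compLeft (Fin k) ∘ₗ coordMapOfColumns b I v = coordMapOfColumns b I (fun j => f ∘ v j) := by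
  refine coordMaps_ext_basis b I (fun i => ?_) (coordMapOfColumns_frame b I hI _) fun j hj => ?_
  · rw [LinearMap.comp_apply, coordMapOfColumns_frame b I hI]
    funext i'
    rw [LinearMap.compLeft_apply, Function.comp_apply, AlgHom.toLinearMap_apply, Pi.single_apply, Pi.single_apply, apply_ite f,
      map_one, map_zero]
  · rw [LinearMap.comp_apply, coordMapOfColumns_basis b I _ j hj, coordMapOfColumns_basis b I _ j hj]
    rfl

/-! ## §2 The universal coordinate map over the polynomial ring -/

/-- The universal coordinate map is normalised on the `I`-columns. [cite: StacksProject, Tag 089T] -/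
theorem univCoordMap_frame (b : Module.Basis J R M) (I : Fin k → J) (hI : Function.Injective I) (i : Fin k) :
    univCoordMap b I ((⇑b ∘ I) i) = Pi.single i 1 :=
  coordMapOfColumns_frame b I hI _ i

/-- **Evaluating the variables at `v` turns the universal coordinate map into the coordinate map with columns `v`.**
[cite: StacksProject, Tag 089T] -/
theorem aeval_compLeft_univCoordMap {S : Type*} [CommRing S] [Algebra R S] (b : Module.Basis J R M) (I : Fin k → J)
    (hI : Function.Injective I) (v : {j : J // j ∉ Set.range I} × Fin k → S) :
    (MvPolynomial.aeval v).toLinearMap.compLeft (Fin k) ∘ₗ univCoordMap b I = coordMapOfColumns b I fun j i => v (j, i) := by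
  rw [univCoordMap, compLeft_comp_coordMapOfColumns _ b I hI]
  congr 1
  funext j i
  rw [Function.comp_apply, MvPolynomial.aeval_X]

/-- **An `R`-algebra map out of `P` is determined by its composite with the universal coordinate map** (it is determined on the
variables `X_{(j,i)} = (univCoordMap (b j)) i`). [cite: StacksProject, Tag 089T] -/
theorem algHom_ext_univCoordMap {S : Type*} [CommRing S] [Algebra R S] (b : Module.Basis J R M) (I : Fin k → J)
    {φ φ' : MvPolynomial ({j : J // j ∉ Set.range I} × Fin k) R →ₐ[R] S}
    (h : φ.toLinearMap.compLeft (Fin k) ∘ₗ univCoordMap b I = φ'.toLinearMap.compLeft (Fin k) ∘ₗ univCoordMap b I) : φ = φ' := by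
  refine MvPolynomial.algHom_ext fun p => ?_
  obtain ⟨j, i⟩ := p
  have hj := congr_fun (LinearMap.congr_fun h (b j.1)) i
  rw [LinearMap.comp_apply, LinearMap.comp_apply, LinearMap.compLeft_apply, LinearMap.compLeft_apply, Function.comp_apply,
    Function.comp_apply, univCoordMap, coordMapOfColumns_basis b I _ j.1 j.2] at hj
  exact hj

/-! ## §3 The universal chart point and the universal property -/

/-- Chart points of equal coordinate maps are equal (proof-irrelevance plumbing for ★ `ofCoordMap`). [cite: StacksProject, Tag 089T] -/
theorem ofCoordMap_congr {S : Type*} [CommRing S] [Algebra R S] (x : Fin k → M) {ψ ψ' : M →ₗ[R] (Fin k → S)} (h : ψ = ψ')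
    (hψ : ∀ i, ψ (x i) = Pi.single i 1) (hψ' : ∀ i, ψ' (x i) = Pi.single i 1) : ofCoordMap x ψ hψ = ofCoordMap x ψ' hψ' := by
  subst h
  rfl

/-- **`ofCoordMap` is injective in the coordinate map** ((C4): it is the inverse of ★ `chartEquivCoordMaps`). [cite: StacksProject, Tag 089T] -/
theorem ofCoordMap_injective {S : Type*} [CommRing S] [Algebra R S] (x : Fin k → M) {ψ ψ' : M →ₗ[R] (Fin k → S)}
    (hψ : ∀ i, ψ (x i) = Pi.single i 1) (hψ' : ∀ i, ψ' (x i) = Pi.single i 1) (h : ofCoordMap x ψ hψ = ofCoordMap x ψ' hψ') :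
    ψ = ψ' :=
  congrArg Subtype.val ((chartEquivCoordMaps R M k x S).symm.injective (a₁ := ⟨ψ, hψ⟩) (a₂ := ⟨ψ', hψ'⟩) (Subtype.ext h))

/-- The universal point lies in the chart. [cite: StacksProject, Tag 089T] -/
theorem univChart_mem_chart (b : Module.Basis J R M) (I : Fin k → J) (hI : Function.Injective I) :
    univChart b I hI ∈ chart R M k (⇑b ∘ I) (MvPolynomial ({j : J // j ∉ Set.range I} × Fin k) R) :=
  ofCoordMap_mem_chart _ _ _

section SameUniverse

/-! `Module.Grassmannian.map` needs source and target rings in one universe; the polynomial ring lives in `Type (max v u)`. -/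

variable {S : Type (max v u)} [CommRing S] [Algebra R S]

/-- **Base change of the universal point along `aeval v` is the chart point with columns `v`.** [cite: StacksProject, Tag 089T] -/
theorem map_aeval_univChart (b : Module.Basis J R M) (I : Fin k → J) (hI : Function.Injective I)
    (v : {j : J // j ∉ Set.range I} × Fin k → S) :
    Module.Grassmannian.map (MvPolynomial.aeval v) (univChart b I hI) =
      ofCoordMap (⇑b ∘ I) (coordMapOfColumns b I fun j i => v (j, i)) (coordMapOfColumns_frame b I hI _) := by
  rw [univChart, map_ofCoordMap]
  congr 1
  exact aeval_compLeft_univCoordMap b I hI v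

/-- **UNIVERSAL PROPERTY OF THE CHART**: every point `N ∈ chart (b ∘ I) S` is the base change of the universal point `univChart`
along a UNIQUE `R`-algebra map `P → S` — namely evaluation at the free columns of `coordMap N`; i.e. `U_I ≅ Hom_R(P, −) = 𝔸^{k · #σ}`
with universal element `univChart`. [cite: StacksProject, Tag 089T] [cite: EisenbudHarris2016, §3.2.2] -/
theorem existsUnique_algHom_map_univChart_eq (b : Module.Basis J R M) (I : Fin k → J) (hI : Function.Injective I)
    (N : Module.Grassmannian S (S ⊗[R] M) k) (hN : N ∈ chart R M k (⇑b ∘ I) S) :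
    ∃! φ : MvPolynomial ({j : J // j ∉ Set.range I} × Fin k) R →ₐ[R] S, Module.Grassmannian.map φ (univChart b I hI) = N := by
  refine ⟨MvPolynomial.aeval fun p : {j : J // j ∉ Set.range I} × Fin k => coordMap _ N hN (b p.1.1) p.2, ?_, fun φ hφ => ?_⟩
  · -- existence: the columns of `coordMap N`
    dsimp only
    rw [map_aeval_univChart b I hI]
    exact (ofCoordMap_congr (⇑b ∘ I) (coordMapOfColumns_restrict b I hI (coordMap (⇑b ∘ I) N hN) (coordMap_frame _ N hN))
      _ _).trans (ofCoordMap_coordMap _ N hN)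
  · -- uniqueness: `φ ∘ ψ_univ` is the coordinate map of `map φ univChart = N`
    dsimp only at hφ
    refine algHom_ext_univCoordMap b I ?_
    rw [aeval_compLeft_univCoordMap b I hI]
    have h1 : ofCoordMap (⇑b ∘ I) (φ.toLinearMap.compLeft (Fin k) ∘ₗ univCoordMap b I)
        (compLeft_comp_frame φ _ _ (univCoordMap_frame b I hI)) = N := by
      rw [← hφ, univChart, map_ofCoordMap]
    have h2 : φ.toLinearMap.compLeft (Fin k) ∘ₗ univCoordMap b I = coordMap (⇑b ∘ I) N hN := by
      have h3 := congrArg (fun N' : chart R M k (⇑b ∘ I) S => (chartEquivCoordMaps R M k (⇑b ∘ I) S N').1)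
        (Subtype.ext (a1 := ⟨_, ofCoordMap_mem_chart (⇑b ∘ I) _ (compLeft_comp_frame φ _ _ (univCoordMap_frame b I hI))⟩)
          (a2 := ⟨N, hN⟩) h1)
      simpa only [chartEquivCoordMaps_apply, coordMap_ofCoordMap] using h3
    rw [h2, coordMapOfColumns_restrict b I hI _ (coordMap_frame _ N hN)]

end SameUniverse

end Grassmannian

end Literature.AlgebraicGeometry.Motives

end
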